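import Summits.CriticalPhenomena.Ising3DConformalLimit.Theses.ReflectionTwin
import Summits.CriticalPhenomena.Ising3DConformalLimit.Theorems.HyperoctahedralRPExistsScaleCovariantLimitDecimationTwoCouplingGKS
import Summits.CriticalPhenomena.Ising3DConformalLimit.Theorems.HyperoctahedralRPExistsScaleCovariantLimitDecimationBoxBridge
import Literature.Probability.LatticeModels.PlanarIsingCriticalBeta
import Literature.Probability.LatticeModels.OnsagerYang
import Literature.Probability.LatticeModels.CriticalTwoPointLower
import Summits.CriticalPhenomena.Ising3DConformalLimit.Theorems.EnergyNotSigmaSquaredGapForcesFarMergingRootOpacityScreen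
import HarnessLib

/-!
# Box geometry of the (111) reflection twin for stub (S) `stub_strongSeamOrder`

Crux `TwinThreshold` (stmt-CriticalPhenomena-16906), line `seam_renewal`, stub `stub_strongSeamOrder` ((S) plane order at
strong seam coupling); second support file (the first is `ReflectionTwinTwinThresholdStrongSeamOrderDecoration.lean`),
imported by the stub file `ReflectionTwinTwinThresholdStrongSeamOrder.lean`. Pure coordinate geometry of `ℤ³` sliced by
the (111) layers `h z = z 0 + z 1 + z 2`, all by `simp`/`omega`; every statement is written in the crux's own inlined
vocabulary (no definitions, no notation):

* §1 `mem_box_two` — boxes in coordinates (`mem_box_three` is reused from the tree).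
* §2 the TWIN ADJACENCY of the crux (nearest neighbours not between the layers `h = 0` and `h = 1`, or a SEAM bond
  `{c, x}`, `h c = 0`, `h x = 1`, `c + x ∈ {e₀, e₁, e₂}`): symmetry (`twinAdj_symm`) and the two ways a decoration is
  adjacent to the plane (`twinAdj_of_nn`: a nearest-neighbour bond from layer `-1`; `twinAdj_of_seam`: a seam bond from
  layer `+1`); the twin pair observable inside the box (`twinObs_pair`) and `|∏ᵢ σ_{zᵢ}| ≤ 1` (`abs_twinObs_le_one`).
* §3 the plane chart `p ↦ (-p₀, p₀-p₁, p₁)` of `{h = 0}` by `ℤ²` (`plane_facts`, `height_plane`, `unplane_mem`,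
  `plane_unplane`, and the registered sub-goal `stub_strongSeamOrder_partG_chart`).
* §4 the DECORATIONS: the square-lattice bond `p — p+(1,0)` of the chart is decorated by the layer-`(-1)` site
  `w = (-p₀-1, p₀-p₁, p₁)` (nearest-neighbour bonds to the plane ends `w + e₀`, `w + e₁`), the bond `p — p+(0,1)` by
  the layer-`(+1)` site `w = (p₀, 1-p₀+p₁, -p₁)` (seam bonds to the plane ends `e₁ - w`, `e₂ - w`): `low_end_facts`,
  `up_end_facts` (the ends are in the box `box 3 (2N+1)`, on the chart of `box 2 N`, distinct, and bonded to `w`),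
  `decLow_facts`, `decUp_facts` (the decoration of each bond of `box 2 N` and its ends).

References: S. Friedli, Y. Velenik, *Statistical Mechanics of Lattice Systems* (CUP 2017) §3.1–§3.2 (boxes, finite-volume
models). Elementary; no definitions, no named-fact hypotheses, no `sorry`.
-/

noncomputable section

namespace Summit.CriticalPhenomena.Ising3DConformalLimit.Cruxes.TwinThreshold.SeamRenewal

open scoped BigOperators Classical
open Filter Topology Finset
open Literature.Probability.LatticeModels
open Summit.CriticalPhenomena.Ising3DConformalLimit.Cruxes.ExistsScaleCovariantLimit.DecimationHomotopyRate

namespace StrongSeamOrder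

/-! ## §1 Boxes of `ℤ²` and `ℤ³` in coordinates

(`mem_box_three : x ∈ box 3 n ↔ …` coordinatewise is reused from the tree,
`EnergyNotSigmaSquaredGapForcesFarMerging.mem_box_three`.) -/

open Summit.CriticalPhenomena.Ising3DConformalLimit.EnergyNotSigmaSquaredGapForcesFarMerging (mem_box_three)

/-- Membership in `box 2 L`, coordinatewise. [folklore] -/
theorem mem_box_two {L : ℕ} {x : Site 2} : x ∈ box 2 L ↔ (-(L : ℤ) ≤ x 0 ∧ x 0 ≤ L) ∧ (-(L : ℤ) ≤ x 1 ∧ x 1 ≤ L) := by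
  rw [mem_box, Fin.forall_fin_two]

/-! ## §2 The twin adjacency and the twin pair observable -/

/-- The twin adjacency is symmetric. [folklore] -/
theorem twinAdj_symm {x y : Site 3}
    (h : ((∑ i, |x i - y i| = 1) ∧ ¬ ((x 0 + x 1 + x 2 = 0 ∧ y 0 + y 1 + y 2 = 1) ∨ (x 0 + x 1 + x 2 = 1 ∧ y 0 + y 1 + y 2 = 0))) ∨
      (((x 0 + x 1 + x 2 = 0 ∧ y 0 + y 1 + y 2 = 1) ∨ (x 0 + x 1 + x 2 = 1 ∧ y 0 + y 1 + y 2 = 0)) ∧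
        ∃ i : Fin 3, x + y = Pi.single i 1)) :
    ((∑ i, |y i - x i| = 1) ∧ ¬ ((y 0 + y 1 + y 2 = 0 ∧ x 0 + x 1 + x 2 = 1) ∨ (y 0 + y 1 + y 2 = 1 ∧ x 0 + x 1 + x 2 = 0))) ∨
      (((y 0 + y 1 + y 2 = 0 ∧ x 0 + x 1 + x 2 = 1) ∨ (y 0 + y 1 + y 2 = 1 ∧ x 0 + x 1 + x 2 = 0)) ∧
        ∃ i : Fin 3, y + x = Pi.single i 1) := by
  have hs : ∑ i, |y i - x i| = ∑ i, |x i - y i| := Finset.sum_congr rfl fun i _ => abs_sub_comm _ _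
  rw [hs, add_comm y x]
  rcases h with ⟨h1, h2⟩ | ⟨h1, h2⟩
  · exact Or.inl ⟨h1, fun h' => h2 (h'.symm.imp And.symm And.symm)⟩
  · exact Or.inr ⟨h1.symm.imp And.symm And.symm, h2⟩

/-- A layer-`(-1)` site is twin-adjacent to its nearest neighbours. [folklore] -/
theorem twinAdj_of_nn {x y : Site 3} (hs : ∑ i, |x i - y i| = 1) (hx : x 0 + x 1 + x 2 = -1) :
    ((∑ i, |x i - y i| = 1) ∧ ¬ ((x 0 + x 1 + x 2 = 0 ∧ y 0 + y 1 + y 2 = 1) ∨ (x 0 + x 1 + x 2 = 1 ∧ y 0 + y 1 + y 2 = 0))) ∨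
      (((x 0 + x 1 + x 2 = 0 ∧ y 0 + y 1 + y 2 = 1) ∨ (x 0 + x 1 + x 2 = 1 ∧ y 0 + y 1 + y 2 = 0)) ∧
        ∃ i : Fin 3, x + y = Pi.single i 1) :=
  Or.inl ⟨hs, fun h => by omega⟩

/-- A layer-`(+1)` site `x` is twin-adjacent (by a seam bond) to every `y` with `x + y = eᵢ`. [folklore] -/
theorem twinAdj_of_seam {x y : Site 3} (hx : x 0 + x 1 + x 2 = 1) (i : Fin 3) (hi : x + y = Pi.single i 1) :
    ((∑ i, |x i - y i| = 1) ∧ ¬ ((x 0 + x 1 + x 2 = 0 ∧ y 0 + y 1 + y 2 = 1) ∨ (x 0 + x 1 + x 2 = 1 ∧ y 0 + y 1 + y 2 = 0))) ∨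
      (((x 0 + x 1 + x 2 = 0 ∧ y 0 + y 1 + y 2 = 1) ∨ (x 0 + x 1 + x 2 = 1 ∧ y 0 + y 1 + y 2 = 0)) ∧
        ∃ i : Fin 3, x + y = Pi.single i 1) := by
  have hsum : (x + y) 0 + (x + y) 1 + (x + y) 2 = 1 := by
    rw [hi]
    fin_cases i <;> simp
  simp only [Pi.add_apply] at hsum
  exact Or.inr ⟨Or.inr ⟨hx, by omega⟩, i, hi⟩

/-- The twin pair observable inside the box: `∏ᵢ σ_{(0,c)ᵢ} = σ₀ σ_c` once `0, c ∈ box 3 L`. [folklore] -/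
theorem twinObs_pair {L : ℕ} {c : Site 3} (h0 : (0 : Site 3) ∈ box 3 L) (hc : c ∈ box 3 L) :
    (fun s => ∏ i, if h : (![0, c] : Fin 2 → Site 3) i ∈ box 3 L then
        spinAt (⟨(![0, c] : Fin 2 → Site 3) i, h⟩ : ↥(box 3 L)) s else 0) =
      fun s => spinAt (⟨0, h0⟩ : ↥(box 3 L)) s * spinAt (⟨c, hc⟩ : ↥(box 3 L)) s := by
  funext s
  rw [Fin.prod_univ_two]
  simp only [Matrix.cons_val_zero, Matrix.cons_val_one]
  rw [dif_pos h0, dif_pos hc]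

/-- `|∏ᵢ σ_{zᵢ}| ≤ 1` for the twin box observable (junk factor `0` off the box). [folklore] -/
theorem abs_twinObs_le_one {k L : ℕ} (z : Fin k → Site 3) (s : SpinConfig ↥(box 3 L)) :
    |∏ i, (if h : z i ∈ box 3 L then spinAt (⟨z i, h⟩ : ↥(box 3 L)) s else 0)| ≤ 1 := by
  rw [Finset.abs_prod]
  refine Finset.prod_le_one (fun i _ => abs_nonneg _) fun i _ => ?_
  split_ifs
  · rw [abs_spinAt]
  · simp

/-! ## §3 The plane chart `ℤ² → {h = 0}`, `p ↦ (-p₀, p₀ - p₁, p₁)` -/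

/-- The chart point of `p ∈ box 2 N` lies in `box 3 (2N+1)`, on the plane, with plane coordinates in `box 2 N`.
[folklore] -/
theorem plane_facts {N : ℕ} {p : Site 2} (hp : p ∈ box 2 N) :
    (![-(p 0), p 0 - p 1, p 1] : Site 3) ∈ box 3 (2 * N + 1) ∧
      ((![-(p 0), p 0 - p 1, p 1] : Site 3) 0 + (![-(p 0), p 0 - p 1, p 1] : Site 3) 1 +
            (![-(p 0), p 0 - p 1, p 1] : Site 3) 2 = 0 ∧
        -(N : ℤ) ≤ -((![-(p 0), p 0 - p 1, p 1] : Site 3) 0) ∧ -((![-(p 0), p 0 - p 1, p 1] : Site 3) 0) ≤ (N : ℤ) ∧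
          -(N : ℤ) ≤ (![-(p 0), p 0 - p 1, p 1] : Site 3) 2 ∧ (![-(p 0), p 0 - p 1, p 1] : Site 3) 2 ≤ (N : ℤ)) := by
  rw [mem_box_two] at hp
  rw [mem_box_three]
  simp only [Matrix.cons_val_zero, Matrix.cons_val_one, Matrix.head_cons, Matrix.cons_val_two, Matrix.tail_cons]
  push_cast
  omega

/-- The height of a chart point is `0`. [folklore] -/
theorem height_plane (p : Site 2) :
    (![-(p 0), p 0 - p 1, p 1] : Site 3) 0 + (![-(p 0), p 0 - p 1, p 1] : Site 3) 1 + (![-(p 0), p 0 - p 1, p 1] : Site 3) 2 =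
      0 := by
  simp only [Matrix.cons_val_zero, Matrix.cons_val_one, Matrix.head_cons, Matrix.cons_val_two, Matrix.tail_cons]
  ring

/-- Plane coordinates `(-q₀, q₂)` of a plane site of the chart of `box 2 N` lie in `box 2 N`. [folklore] -/
theorem unplane_mem {N : ℕ} {q : Site 3}
    (hq : q 0 + q 1 + q 2 = 0 ∧ -(N : ℤ) ≤ -(q 0) ∧ -(q 0) ≤ (N : ℤ) ∧ -(N : ℤ) ≤ q 2 ∧ q 2 ≤ (N : ℤ)) :
    (![-(q 0), q 2] : Site 2) ∈ box 2 N := by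
  rw [mem_box_two]
  simp only [Matrix.cons_val_zero, Matrix.cons_val_one]
  omega

/-- `chart ∘ coordinates = id` on the plane. [folklore] -/
theorem plane_unplane {q : Site 3} (hq : q 0 + q 1 + q 2 = 0) :
    (![-((![-(q 0), q 2] : Site 2) 0), (![-(q 0), q 2] : Site 2) 0 - (![-(q 0), q 2] : Site 2) 1,
      (![-(q 0), q 2] : Site 2) 1] : Site 3) = q := by
  ext i
  fin_cases i
  · simp
  · simp only [Matrix.cons_val_one, Matrix.cons_val_zero, Fin.mk_one]
    omega
  · simp

/-! ## §4 The decorations of the square-lattice bonds of the chart -/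

/-- **Lower decorations.** A layer-`(-1)` site `z` with `(-z₀-1, z₂) ∈ [-N,N-1] × [-N,N]` has its two plane ends
`z + e₀`, `z + e₁` in `box 3 (2N+1)`, on the chart of `box 2 N`, distinct, and at nearest-neighbour distance. [folklore] -/
theorem low_end_facts (N : ℕ) (z : Site 3)
    (h : z 0 + z 1 + z 2 = -1 ∧ -(N : ℤ) ≤ -(z 0) - 1 ∧ -(z 0) ≤ (N : ℤ) ∧ -(N : ℤ) ≤ z 2 ∧ z 2 ≤ (N : ℤ)) :
    ((![z 0 + 1, z 1, z 2] : Site 3) ∈ box 3 (2 * N + 1) ∧ (![z 0, z 1 + 1, z 2] : Site 3) ∈ box 3 (2 * N + 1)) ∧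
      (((![z 0 + 1, z 1, z 2] : Site 3) 0 + (![z 0 + 1, z 1, z 2] : Site 3) 1 + (![z 0 + 1, z 1, z 2] : Site 3) 2 = 0 ∧
          -(N : ℤ) ≤ -((![z 0 + 1, z 1, z 2] : Site 3) 0) ∧ -((![z 0 + 1, z 1, z 2] : Site 3) 0) ≤ (N : ℤ) ∧
            -(N : ℤ) ≤ (![z 0 + 1, z 1, z 2] : Site 3) 2 ∧ (![z 0 + 1, z 1, z 2] : Site 3) 2 ≤ (N : ℤ)) ∧
        ((![z 0, z 1 + 1, z 2] : Site 3) 0 + (![z 0, z 1 + 1, z 2] : Site 3) 1 + (![z 0, z 1 + 1, z 2] : Site 3) 2 = 0 ∧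
          -(N : ℤ) ≤ -((![z 0, z 1 + 1, z 2] : Site 3) 0) ∧ -((![z 0, z 1 + 1, z 2] : Site 3) 0) ≤ (N : ℤ) ∧
            -(N : ℤ) ≤ (![z 0, z 1 + 1, z 2] : Site 3) 2 ∧ (![z 0, z 1 + 1, z 2] : Site 3) 2 ≤ (N : ℤ))) ∧
      (![z 0 + 1, z 1, z 2] : Site 3) ≠ ![z 0, z 1 + 1, z 2] ∧
      (∑ i, |z i - (![z 0 + 1, z 1, z 2] : Site 3) i| = 1) ∧ (∑ i, |z i - (![z 0, z 1 + 1, z 2] : Site 3) i| = 1) := by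
  obtain ⟨hz, h1, h2, h3, h4⟩ := h
  refine ⟨?_, ?_, fun he => ?_, by simp [Fin.sum_univ_three], by simp [Fin.sum_univ_three]⟩
  · rw [mem_box_three, mem_box_three]
    simp only [Matrix.cons_val_zero, Matrix.cons_val_one, Matrix.head_cons, Matrix.cons_val_two, Matrix.tail_cons]
    push_cast
    omega
  · simp only [Matrix.cons_val_zero, Matrix.cons_val_one, Matrix.head_cons, Matrix.cons_val_two, Matrix.tail_cons]
    omega
  · have := congr_fun he 0
    simp at this

/-- **Upper decorations.** A layer-`(+1)` site `z` with `(z₀, -z₂) ∈ [-N,N] × [-N,N-1]` has its two plane ends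
`e₁ - z`, `e₂ - z` in `box 3 (2N+1)`, on the chart of `box 2 N`, distinct, and joined to `z` by seam bonds. [folklore] -/
theorem up_end_facts (N : ℕ) (z : Site 3)
    (h : z 0 + z 1 + z 2 = 1 ∧ -(N : ℤ) ≤ z 0 ∧ z 0 ≤ (N : ℤ) ∧ -(N : ℤ) ≤ -(z 2) ∧ -(z 2) + 1 ≤ (N : ℤ)) :
    ((![-(z 0), 1 - z 1, -(z 2)] : Site 3) ∈ box 3 (2 * N + 1) ∧ (![-(z 0), -(z 1), 1 - z 2] : Site 3) ∈ box 3 (2 * N + 1)) ∧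
      (((![-(z 0), 1 - z 1, -(z 2)] : Site 3) 0 + (![-(z 0), 1 - z 1, -(z 2)] : Site 3) 1 +
              (![-(z 0), 1 - z 1, -(z 2)] : Site 3) 2 = 0 ∧
          -(N : ℤ) ≤ -((![-(z 0), 1 - z 1, -(z 2)] : Site 3) 0) ∧ -((![-(z 0), 1 - z 1, -(z 2)] : Site 3) 0) ≤ (N : ℤ) ∧
            -(N : ℤ) ≤ (![-(z 0), 1 - z 1, -(z 2)] : Site 3) 2 ∧ (![-(z 0), 1 - z 1, -(z 2)] : Site 3) 2 ≤ (N : ℤ)) ∧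
        ((![-(z 0), -(z 1), 1 - z 2] : Site 3) 0 + (![-(z 0), -(z 1), 1 - z 2] : Site 3) 1 +
              (![-(z 0), -(z 1), 1 - z 2] : Site 3) 2 = 0 ∧
          -(N : ℤ) ≤ -((![-(z 0), -(z 1), 1 - z 2] : Site 3) 0) ∧ -((![-(z 0), -(z 1), 1 - z 2] : Site 3) 0) ≤ (N : ℤ) ∧
            -(N : ℤ) ≤ (![-(z 0), -(z 1), 1 - z 2] : Site 3) 2 ∧ (![-(z 0), -(z 1), 1 - z 2] : Site 3) 2 ≤ (N : ℤ))) ∧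
      (![-(z 0), 1 - z 1, -(z 2)] : Site 3) ≠ ![-(z 0), -(z 1), 1 - z 2] ∧
      z + ![-(z 0), 1 - z 1, -(z 2)] = Pi.single 1 1 ∧ z + ![-(z 0), -(z 1), 1 - z 2] = Pi.single 2 1 := by
  obtain ⟨hz, h1, h2, h3, h4⟩ := h
  refine ⟨?_, ?_, fun he => ?_, ?_, ?_⟩
  · rw [mem_box_three, mem_box_three]
    simp only [Matrix.cons_val_zero, Matrix.cons_val_one, Matrix.head_cons, Matrix.cons_val_two, Matrix.tail_cons]
    push_cast
    omega
  · simp only [Matrix.cons_val_zero, Matrix.cons_val_one, Matrix.head_cons, Matrix.cons_val_two, Matrix.tail_cons]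
    omega
  · have := congr_fun he 1
    simp only [Matrix.cons_val_one, Matrix.cons_val_zero] at this
    omega
  · ext i; fin_cases i <;> simp
  · ext i; fin_cases i <;> simp

/-- **The decoration of the bond `a — a + (1,0)` of `box 2 N`** is the layer-`(-1)` site `w = (-a₀-1, a₀-a₁, a₁)`: a lower
decoration in `box 3 (2N+1)` whose ends `w + e₀`, `w + e₁` are the chart points of `a` and `a + (1,0)`. [folklore] -/
theorem decLow_facts {N : ℕ} {a : Site 2} (ha : a ∈ box 2 N) (hb : a + Pi.single 0 1 ∈ box 2 N) {w : Site 3}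
    (hw : w = ![-(a 0) - 1, a 0 - a 1, a 1]) :
    (w 0 + w 1 + w 2 = -1 ∧ -(N : ℤ) ≤ -(w 0) - 1 ∧ -(w 0) ≤ (N : ℤ) ∧ -(N : ℤ) ≤ w 2 ∧ w 2 ≤ (N : ℤ)) ∧
      w ∈ box 3 (2 * N + 1) ∧ (![w 0 + 1, w 1, w 2] : Site 3) = ![-(a 0), a 0 - a 1, a 1] ∧
        (![w 0, w 1 + 1, w 2] : Site 3) =
          ![-((a + Pi.single 0 1 : Site 2) 0), (a + Pi.single 0 1 : Site 2) 0 - (a + Pi.single 0 1 : Site 2) 1,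
            (a + Pi.single 0 1 : Site 2) 1] := by
  subst hw
  rw [mem_box_two] at ha hb
  simp only [Pi.add_apply, Pi.single_eq_same, Pi.single_eq_of_ne (one_ne_zero : (1 : Fin 2) ≠ 0)] at hb ⊢
  refine ⟨?_, ?_, ?_, ?_⟩
  · simp only [Matrix.cons_val_zero, Matrix.cons_val_one, Matrix.head_cons, Matrix.cons_val_two, Matrix.tail_cons]
    omega
  · rw [mem_box_three]
    simp only [Matrix.cons_val_zero, Matrix.cons_val_one, Matrix.head_cons, Matrix.cons_val_two, Matrix.tail_cons]
    push_cast
    omega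
  · ext i
    fin_cases i
    · simp only [Fin.zero_eta, Matrix.cons_val_zero]
      ring
    · simp
    · simp
  · ext i
    fin_cases i
    · simp only [Fin.zero_eta, Matrix.cons_val_zero]
      ring
    · simp only [Fin.mk_one, Matrix.cons_val_one, Matrix.cons_val_zero]
      ring
    · simp

/-- **The decoration of the bond `a — a + (0,1)` of `box 2 N`** is the layer-`(+1)` site `w = (a₀, 1-a₀+a₁, -a₁)`: an upper
decoration in `box 3 (2N+1)` whose ends `e₁ - w`, `e₂ - w` are the chart points of `a` and `a + (0,1)`. [folklore] -/
theorem decUp_facts {N : ℕ} {a : Site 2} (ha : a ∈ box 2 N) (hb : a + Pi.single 1 1 ∈ box 2 N) {w : Site 3}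
    (hw : w = ![a 0, 1 - a 0 + a 1, -(a 1)]) :
    (w 0 + w 1 + w 2 = 1 ∧ -(N : ℤ) ≤ w 0 ∧ w 0 ≤ (N : ℤ) ∧ -(N : ℤ) ≤ -(w 2) ∧ -(w 2) + 1 ≤ (N : ℤ)) ∧
      w ∈ box 3 (2 * N + 1) ∧ (![-(w 0), 1 - w 1, -(w 2)] : Site 3) = ![-(a 0), a 0 - a 1, a 1] ∧
        (![-(w 0), -(w 1), 1 - w 2] : Site 3) =
          ![-((a + Pi.single 1 1 : Site 2) 0), (a + Pi.single 1 1 : Site 2) 0 - (a + Pi.single 1 1 : Site 2) 1,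
            (a + Pi.single 1 1 : Site 2) 1] := by
  subst hw
  rw [mem_box_two] at ha hb
  simp only [Pi.add_apply, Pi.single_eq_same, Pi.single_eq_of_ne (zero_ne_one : (0 : Fin 2) ≠ 1)] at hb ⊢
  refine ⟨?_, ?_, ?_, ?_⟩
  · simp only [Matrix.cons_val_zero, Matrix.cons_val_one, Matrix.head_cons, Matrix.cons_val_two, Matrix.tail_cons]
    omega
  · rw [mem_box_three]
    simp only [Matrix.cons_val_zero, Matrix.cons_val_one, Matrix.head_cons, Matrix.cons_val_two, Matrix.tail_cons]
    push_cast
    omega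
  · ext i
    fin_cases i
    · simp
    · simp only [Fin.mk_one, Matrix.cons_val_one, Matrix.cons_val_zero]
      ring
    · simp
  · ext i
    fin_cases i
    · simp
    · simp only [Fin.mk_one, Matrix.cons_val_one, Matrix.cons_val_zero]
      ring
    · simp only [Fin.reduceFinMk, Matrix.cons_val]
      ring

end StrongSeamOrder

/-! ## Registered sub-goal of stub (S): the plane chart is a chart -/

/-- **Sub-goal `stub_strongSeamOrder_partG_chart` of stub (S)** — `coordinates ∘ chart = id`: the plane coordinates
`(-q₀, q₂)` of the chart point `q = (-p₀, p₀-p₁, p₁)` are `p`. [folklore] -/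
theorem stub_strongSeamOrder_partG_chart : open Literature.Probability.LatticeModels in (∀ p : Site 2, (![-((![-(p 0), p 0 - p 1, p 1] : Site 3) 0), (![-(p 0), p 0 - p 1, p 1] : Site 3) 2] : Site 2) = p) := by
  intro p
  ext i
  fin_cases i <;> simp

end Summit.CriticalPhenomena.Ising3DConformalLimit.Cruxes.TwinThreshold.SeamRenewal

end
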